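import Summits.BirchSwinnertonDyer.BirchSwinnertonDyer.Theorems.GenusKolyvaginAtTwoPowDvdShaCardAtTwoPosTBottomRungAuxiliaryDeepTransposition
import Summits.BirchSwinnertonDyer.BirchSwinnertonDyer.Theorems.GenusKolyvaginAtTwoPowDvdShaCardAtTwoPosTBottomRungLocalTransposition
import Summits.BirchSwinnertonDyer.BirchSwinnertonDyer.Theorems.GenusKolyvaginAtTwoPowDvdShaCardAtTwoRTBottomRungEngine
import HarnessLib

/-!
# Route `GenusKolyvaginAtTwo`, crux L⁺_T `PowDvdShaCardAtTwoPosT` (stmt-BirchSwinnertonDyer-23379), road «E4⁺», socket hbot⁺ (LEAD R10″) —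
# LAYER 4: THE ONE-STEP ENGINE OF THE BOTTOM RUNG AT REGULAR (TRANSPOSITION-DEEP) PRIMES — a `k`-minimal primitive product with a FREE own
# prime is impossible, MODULO NAMED `K`-SIDE INPUTS; no sign condition on `Δ`

Seat `bsd-line-gk2-p4` g24 (WIDTH-5 attach, cell `bsd-f1-sign2`), `--supports stmt-BirchSwinnertonDyer-23379 --as helper`.
THEOREMS ONLY (no definition, no named fact, no `sorry`).  BSD is NOT proved by any of this; L⁺_T / Q4_T are NOT claimed; nothing is closed.

WHAT.  LEAD g16's `RelaxedCount.false_of_bottomRung_engine` (`…RTBottomRungEngine`) VERBATIM except: `(hΔ : W.Δ < 0)` deleted; the Gross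
condition `FrobEqFrobInfty W K 2 ℓ` on the own primes `s ∪ t` replaced by the sibling engine's regular clause on `E[2]` at the place; the level-`4`
condition `ht4` on `t` dropped; `FrobEqFrobInfty W K (2^2) ·` at the new prime `ℓ′` and at the free primes replaced by the regular clause at
level `4` (involution on `E[4]` moving a `2`-torsion point — gk2-p2 g22's transposition-deep primes, `…PosTBottomRungLocalTransposition` §0);
the transversality clause (tr) at the deep own primes quantified over every Frobenius above the place (no complex conjugation).  Proof
verbatim over layers 1–3 (`…PosTBottomRungLocalTransposition`, `…AuxiliaryTransposition`, `…AuxiliaryDeepTransposition`).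
* §0 `regularFrob_two_of_level` — the level-`2^M` regular clause at a place implies the level-`2` one (restriction `E[2] ⊆ E[2^M]`).
* §1 **`false_of_bottomRung_engine_regular`**.

HONEST FRAMING.  Port of LEAD g16's composition; closes nothing; BSD is not proved.

References: [McCallumLMS1991] §4 Prop. 4.4, §5 Lemma 5.3 and proof of Prop. 5.2; [GrossLMS1991] §3 (3.1)–(3.3), Prop. 6.2, §9;
[MilneADT2006] I Thm. 4.10.
-/

set_option autoImplicit false
-- the Theorems namespace of this sub repeats the summit name by design (D-0017 nested layout)
set_option linter.dupNamespace false

noncomputable section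

open scoped Classical

open Field NumberField IsDedekindDomain Function WeierstrassCurve
open Literature.NumberTheory.EllipticCurves
open Literature.NumberTheory.GaloisRepresentations
open Literature.NumberTheory.GaloisCohomology
open Summit.BirchSwinnertonDyer.Rank1Residual.X11b.FiniteDuality
open Summit.BirchSwinnertonDyer.Rank1Residual.X11b.Relaxation
open Summit.BirchSwinnertonDyer.BirchSwinnertonDyer.Theorems.GenusExact.SelmerDescent
open Summit.BirchSwinnertonDyer.BirchSwinnertonDyer.Theorems.GenusExact.DeepOwnPrime
open Summit.BirchSwinnertonDyer.BirchSwinnertonDyer.Theorems.SchneiderFreeAdditiveX3.PoitouTateReduction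
open Summit.BirchSwinnertonDyer.BirchSwinnertonDyer.Theorems.OffBigImageOddLocalAtTwo.Engine (zsmul_mem_torsionLocalKer_iff_resTorsion_of_notMem_regular)

namespace Summit.BirchSwinnertonDyer.BirchSwinnertonDyer.Theorems.GenusExact.RelaxedCount

variable (W : WeierstrassCurve ℚ) [W.IsElliptic] [W.IsGloballyMinimal]

/-! ## §0 Level `2^M` regular clause ⟹ level `2` regular clause -/

omit [W.IsElliptic] [W.IsGloballyMinimal] in
/-- The regular clause at level `2^M` (`M ≥ 1`: some Frobenius above the place is an involution of `E[2^M]` moving a point of `E[2]`) gives the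
clause on `E[2]` (restrict to `E[2] ⊆ E[2^M]`). [folklore] -/
theorem regularFrob_two_of_level {v : HeightOneSpectrum (𝓞 ℚ)} {M : ℕ} (hM : 1 ≤ M)
    (hreg : ∃ (𝔓₀ : Ideal (absIntegers (𝓞 ℚ) ℚ)) (h : absoluteGaloisGroup ℚ), 𝔓₀ ∈ v.primesAbove ∧
      IsArithFrobAt (𝓞 ℚ) h 𝔓₀ ∧ (∀ X : geomTorsion W ((2 ^ M : ℕ) : ℤ), h • h • X = X) ∧ ∃ u : geomTorsion W 2, h • u ≠ u) :
    ∃ (𝔓 : Ideal (absIntegers (𝓞 ℚ) ℚ)) (h : absoluteGaloisGroup ℚ), 𝔓 ∈ v.primesAbove ∧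
      IsArithFrobAt (𝓞 ℚ) h 𝔓 ∧ (∀ P : geomTorsion W ((2 : ℕ) : ℤ), h • h • P = P) ∧
      ∃ u : geomTorsion W ((2 : ℕ) : ℤ), h • u ≠ u := by
  obtain ⟨𝔓₀, h, h𝔓₀, hh, hinv, u, hu⟩ := hreg
  have hu2 : (u : geomPoints W) ∈ geomTorsion W ((2 : ℕ) : ℤ) := by
    rw [mem_geomTorsion_iff]
    exact_mod_cast (mem_geomTorsion_iff W 2 _).mp u.2
  refine ⟨𝔓₀, h, h𝔓₀, hh, fun P ↦ ?_, ⟨u.1, hu2⟩, fun e ↦ hu (Subtype.ext (congrArg Subtype.val e))⟩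
  -- `E[2] ⊆ E[2^M]`
  obtain ⟨m, rfl⟩ : ∃ m, M = m + 1 := ⟨M - 1, by omega⟩
  have hP : (P : geomPoints W) ∈ geomTorsion W ((2 ^ (m + 1) : ℕ) : ℤ) := by
    rw [mem_geomTorsion_iff]
    have h2 : ((2 : ℕ) : ℤ) • (P : geomPoints W) = 0 := (mem_geomTorsion_iff W _ _).mp P.2
    have e : ((2 ^ (m + 1) : ℕ) : ℤ) = (2 ^ m : ℤ) * ((2 : ℕ) : ℤ) := by push_cast; ring
    rw [e, mul_smul, h2, smul_zero]
  have key : ∀ (Q : geomPoints W) (hQ : Q ∈ geomTorsion W ((2 ^ (m + 1) : ℕ) : ℤ)), h • h • Q = Q := fun Q hQ ↦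
    congrArg Subtype.val (hinv ⟨Q, hQ⟩)
  exact Subtype.ext (key P.1 hP)

/-! ## §1 The one-step engine at regular primes -/

/-- **The one-step engine of the bottom rung (index `≥ 2`, even depth) at REGULAR primes, modulo named inputs** — LEAD g16's
`false_of_bottomRung_engine` with every Gross–Kolyvagin condition `FrobEqFrobInfty` replaced by the regular clause at the place (on `E[2]` for the
own primes `s ∪ t`, on `E[4]` for the new prime `ℓ′` and the free primes — transposition-deep primes qualify by
`regularFrob_level_of_transposition` / `regularFrob_two_of_transposition`), the level-`4` condition on `t` dropped, and the transversality (tr) of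
`2•Z` at the deep own primes quantified over every Frobenius above them; `Δ` of any sign.  Then `False` — the `k`-minimal primitive product has
NO free own prime. [cite: McCallumLMS1991, §5 proof of Prop. 5.2] [cite: GrossLMS1991, Prop. 6.2 and §9] [cite: MilneADT2006, Ch. I, Thm. 4.10] -/
theorem false_of_bottomRung_engine_regular (hρ2 : W.HasSurjectiveModNGaloisRep 2)
    {K : Type} [Field K] [NumberField K] (hK : IsImaginaryQuadratic K) {θ : K} (hθ : θ ∉ (algebraMap ℚ K).range) {c : ℤ}
    (hc : θ ^ 2 = algebraMap ℚ K c)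
    (s t : Finset (Place ℚ)) (hst : Disjoint s t) (hs : s.Nonempty)
    (hTK : ∀ u ∈ s ∪ t, ∃ (v : HeightOneSpectrum (𝓞 ℚ)) (ℓ : ℕ) (_ : Fact ℓ.Prime), u = Sum.inr v ∧ ℓ ≠ 2 ∧ (ℓ : 𝓞 ℚ) ∈ v.asIdeal ∧
      W.HasGoodReductionAtPrime ℓ ∧
      (∃ (𝔓 : Ideal (absIntegers (𝓞 ℚ) ℚ)) (h : absoluteGaloisGroup ℚ), 𝔓 ∈ v.primesAbove ∧
        IsArithFrobAt (𝓞 ℚ) h 𝔓 ∧ (∀ P : geomTorsion W ((2 : ℕ) : ℤ), h • h • P = P) ∧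
        ∃ u : geomTorsion W ((2 : ℕ) : ℤ), h • u ≠ u) ∧
      2 ≤ Zhang2014.kolyvaginIndex W 2 ℓ)
    (hstep : ∀ y ∈ kummerOutside W (2 ^ 2) (s ∪ t), 2 • y ≠ 0 →
      ∃ (v' : HeightOneSpectrum (𝓞 ℚ)) (ℓ' : ℕ) (_ : Fact ℓ'.Prime) (w' : HeightOneSpectrum (𝓞 K))
        (_ : w'.asIdeal.LiesOver v'.asIdeal) (Z : galoisCohomology (W.torsionGaloisModule ((2 ^ 2 : ℕ) : ℤ)) 1)
        (cK cK' : galH1Torsion (W.baseChange K) ((2 ^ 2 : ℕ) : ℤ)),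
        (Sum.inr v' : Place ℚ) ∉ s ∪ t ∧ ℓ' ≠ 2 ∧ (ℓ' : 𝓞 ℚ) ∈ v'.asIdeal ∧ W.HasGoodReductionAtPrime ℓ' ∧
        ((c : ℤ) : 𝓞 ℚ) ∉ v'.asIdeal ∧
        (∃ (𝔓₀ : Ideal (absIntegers (𝓞 ℚ) ℚ)) (h : absoluteGaloisGroup ℚ), 𝔓₀ ∈ v'.primesAbove ∧
          IsArithFrobAt (𝓞 ℚ) h 𝔓₀ ∧ (∀ X : geomTorsion W ((2 ^ 2 : ℕ) : ℤ), h • h • X = X) ∧ ∃ u : geomTorsion W 2, h • u ≠ u) ∧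
        2 ≤ Zhang2014.kolyvaginIndex W 2 ℓ' ∧
        w'.asIdeal.inertiaDeg (𝓞 ℚ) = 2 ∧
        resTorsion W K ((2 ^ 2 : ℕ) : ℤ) Z = cK' ∧
        (∀ v : HeightOneSpectrum (𝓞 ℚ), (Sum.inr v : Place ℚ) ∉ insert (Sum.inr v' : Place ℚ) (s ∪ t) →
          ∀ w : HeightOneSpectrum (𝓞 K), w.asIdeal.LiesOver v.asIdeal →
            cK' ∈ selmerLocalKer (W.baseChange K) (w.adicCompletion K) ((2 ^ 2 : ℕ) : ℤ)) ∧
        (∀ j : ℕ,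
          (((2 ^ j : ℕ) : ℤ) • cK' ∈ selmerLocalKer (W.baseChange K) (w'.adicCompletion K) ((2 ^ 2 : ℕ) : ℤ) ↔
            ((2 ^ j : ℕ) : ℤ) • cK' ∈ (W.baseChange K).torsionLocalKer (w'.adicCompletion K) ((2 ^ 2 : ℕ) : ℤ)) ∧
          (((2 ^ j : ℕ) : ℤ) • cK' ∈ (W.baseChange K).torsionLocalKer (w'.adicCompletion K) ((2 ^ 2 : ℕ) : ℤ) ↔
            ((2 ^ j : ℕ) : ℤ) • cK ∈ (W.baseChange K).torsionLocalKer (w'.adicCompletion K) ((2 ^ 2 : ℕ) : ℤ))) ∧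
        (∀ j : ℕ, ((2 ^ j : ℕ) : ℤ) • cK ∈ (W.baseChange K).torsionLocalKer (w'.adicCompletion K) ((2 ^ 2 : ℕ) : ℤ) ↔ 2 ≤ j) ∧
        (∀ j : ℕ, ((2 ^ j : ℕ) : ℤ) • resTorsion W K ((2 ^ 2 : ℕ) : ℤ) y ∈
          (W.baseChange K).torsionLocalKer (w'.adicCompletion K) ((2 ^ 2 : ℕ) : ℤ) ↔ 2 ≤ j) ∧
        (∀ u ∈ s, ∃ (v : HeightOneSpectrum (𝓞 ℚ)) (ℓ : ℕ) (w : HeightOneSpectrum (𝓞 K)) (_ : w.asIdeal.LiesOver v.asIdeal)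
          (cKu : galH1Torsion (W.baseChange K) ((2 ^ 2 : ℕ) : ℤ)),
          u = Sum.inr v ∧ ℓ.Prime ∧ (ℓ : 𝓞 ℚ) ∈ v.asIdeal ∧ ((c : ℤ) : 𝓞 ℚ) ∉ v.asIdeal ∧
          (∃ (𝔓₀ : Ideal (absIntegers (𝓞 ℚ) ℚ)) (h : absoluteGaloisGroup ℚ), 𝔓₀ ∈ v.primesAbove ∧
            IsArithFrobAt (𝓞 ℚ) h 𝔓₀ ∧ (∀ X : geomTorsion W ((2 ^ 2 : ℕ) : ℤ), h • h • X = X) ∧ ∃ u : geomTorsion W 2, h • u ≠ u) ∧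
          w.asIdeal.inertiaDeg (𝓞 ℚ) = 2 ∧
          (((2 ^ 1 : ℕ) : ℤ) • cK' ∈ (W.baseChange K).torsionLocalKer (w.adicCompletion K) ((2 ^ 2 : ℕ) : ℤ) ↔
            ((2 ^ 1 : ℕ) : ℤ) • cKu ∈ (W.baseChange K).torsionLocalKer (w.adicCompletion K) ((2 ^ 2 : ℕ) : ℤ)) ∧
          (2 : ℤ) • cKu = 0) ∧
        (∀ v : HeightOneSpectrum (𝓞 ℚ), Sum.inr v ∈ t →
          ∀ 𝔓 ∈ v.primesAbove, ∀ F : absoluteGaloisGroup ℚ, IsArithFrobAt (𝓞 ℚ) F 𝔓 →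
            ∃ P₁ : geomTorsion W ((2 ^ 2 : ℕ) : ℤ), h1Eval W _ ((2 : ℕ) • Z) F = F • P₁ - P₁)) :
    False := by
  -- (adapted from LEAD g16 `false_of_bottomRung_engine`; Gross–Kolyvagin dictionary/count ↦ the regular ones)
  haveI : NeZero (2 ^ 2) := ⟨by norm_num⟩
  have h2K : Module.finrank ℚ K = 2 := hK.1
  -- a Weil pairing at level `4` (tree theorem) and the canonical Poitou–Tate family
  obtain ⟨e, hμ, hadd₁, hadd₂, halt, hnondeg, hgal⟩ := W.exists_weilPairing_holds (2 ^ 2) (by norm_num) (by norm_num)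
  set inv : LocalInvariants ℚ (2 ^ 2) := LocalInvariants.canonical ℚ (2 ^ 2) with hinvdef
  have hperf := LocalInvariants.canonical_isPerfect (K := ℚ) (n := 2 ^ 2)
  -- the auxiliary class and the reciprocity it feeds
  obtain ⟨y, hyKO, hy2, hrec⟩ := exists_auxiliary_bottomRung_regular W e hμ hadd₁ hadd₂ hgal halt hnondeg inv hρ2 s t hst hs hTK
    (fun v _ ↦ (hperf v).1.1) (sumLocalTermEqZero_canonical (K := ℚ) (2 ^ 2))
  -- the step data for this `y`
  obtain ⟨v', ℓ', hℓ'p, w', hw', Z, cK, cK', hv'out, hℓ'2, hℓ'v, hgood', hcv', hFrob4', hidx', hf', hZ, hKum, hRel, hOrdZ, hOrdY,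
    hfree, htr⟩ := hstep y hyKO hy2
  have hgoodv' : W.HasGoodReductionAt v' := VisiblePairAtTwo.hasGoodReductionAt_of_hasGoodReductionAtPrime W hgood' hℓ'v
  have hreg2' := regularFrob_two_of_level W (M := 2) (by norm_num) hFrob4'
  have h22 : (1 : ℕ) ≤ 2 := by norm_num
  -- (hX): `2•Z` Kummer off `s ∪ t ∪ {ℓ′}`
  have hX : (2 : ℕ) • Z ∈ kummerOutside W (2 ^ 2) (insert (Sum.inr v' : Place ℚ) (s ∪ t)) :=
    two_nsmul_mem_kummerOutside_of_isImaginaryQuadratic W K hK (2 ^ 2) _ Z fun v hv w hw ↦ by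
      haveI := hw
      rw [hZ]
      exact hKum v hv w hw
  -- (hXs): `loc_u (2•Z) = 0` at the free primes
  have hXs : ∀ u ∈ s, galoisCohomology.localization (W.torsionGaloisModule ((2 ^ 2 : ℕ) : ℤ)) u 1 ((2 : ℕ) • Z) = 0 := by
    intro u hu
    obtain ⟨v, ℓ, w, hw, cKu, huv, hℓp, hℓv, hcv, hFrob4, hf, hRel₁, hcKu⟩ := hfree u hu
    obtain ⟨v₀, ℓ₀, hℓ₀p, huv₀, hℓ₀2, hℓ₀v, hgood₀, -, -⟩ := hTK u (Finset.mem_union_left t hu)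
    subst huv
    have hvv : v = v₀ := Sum.inr_injective huv₀
    subst hvv
    haveI := hw
    -- `ℓ = ℓ₀`: both lie in `v`
    have hℓℓ : ℓ = ℓ₀ := by
      have h1 := VisiblePairAtTwo.natGenerator_eq_of_natCast_prime_mem hℓp hℓv
      have h2 := VisiblePairAtTwo.natGenerator_eq_of_natCast_prime_mem hℓ₀p.out hℓ₀v
      exact h1.symm.trans h2
    subst hℓℓ
    have hgoodv : W.HasGoodReductionAt v := VisiblePairAtTwo.hasGoodReductionAt_of_hasGoodReductionAtPrime W hgood₀ hℓv
    exact localization_two_nsmul_eq_zero_of_K_regular W h22 (q := 2 ^ 2) rfl hℓp hℓ₀2 hℓv hgoodv h2K hθ hc hcv hFrob4 w hf hZ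
      hRel₁ hcKu
  -- the `ℓ′`-term vanishes …
  have hzero := hrec (Sum.inr v') hv'out Z hX hXs htr
  -- … and does not vanish
  have hyK : y ∈ selmerLocalKer W (v'.adicCompletion ℚ) ((2 ^ 2 : ℕ) : ℤ) :=
    (res_mem_kummerLocalConditionAt_iff W ((2 ^ 2 : ℕ) : ℤ) (Place.Completion (Sum.inr v' : Place ℚ)) y).mp
      ((mem_kummerOutside_iff W (2 ^ 2) (s ∪ t) y).mp hyKO _ hv'out)
  have hOrdYℚ : ∀ j : ℕ, ((2 ^ j : ℕ) : ℤ) • y ∈ W.torsionLocalKer (v'.adicCompletion ℚ) ((2 ^ 2 : ℕ) : ℤ) ↔ 2 ≤ j := fun j ↦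
    (zsmul_mem_torsionLocalKer_iff_resTorsion_of_notMem_regular W h22 (q := 2 ^ 2) rfl hℓ'p.out hℓ'2 hℓ'v hgoodv' h2K hθ hc hcv'
      hFrob4' w' hf' y _).trans (hOrdY j)
  obtain ⟨hmeet, hz'⟩ := bottomRung_newPrime_inputs_of_K_regular W h22 (q := 2 ^ 2) rfl hℓ'p.out hℓ'2 hℓ'v hgoodv' h2K hθ hc hcv'
    hFrob4' w' hf' hZ hRel hOrdZ
  have hz : (2 : ℤ) • galoisCohomology.localization (W.torsionGaloisModule ((2 ^ 2 : ℕ) : ℤ)) (Sum.inr v') 1 Z ≠ 0 := by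
    have h21 : ((2 ^ (2 - 1) : ℕ) : ℤ) = 2 := by norm_num
    rwa [h21] at hz'
  have hF := annLeft_invWeilPairing_kummerSelmerStructure_le_canonical W e hμ hadd₁ hadd₂ hgal halt hnondeg (p := 2) (k := 2)
    two_ne_zero v' (LocalDualityOrder.two_notMem_of_odd_prime_mem hℓ'2 hℓ'v)
  exact invWeilPairing_localization_ne_zero_of_newPrime_regular W (2 ^ 2) e hμ hadd₁ hadd₂ hgal hℓ'2 hgood' hℓ'v hreg2' h22 hidx' rfl
    inv hF hyK hOrdYℚ hmeet hz hzero

end Summit.BirchSwinnertonDyer.BirchSwinnertonDyer.Theorems.GenusExact.RelaxedCount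

end
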